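import Literature.NumberTheory.Automorphic.HeckeIntegrandPureTensorOnBox
import Literature.NumberTheory.Automorphic.WhittakerCoeffTransposeInvGL2
import Literature.NumberTheory.Automorphic.JPSSGlobalFunctionalEquation
import Literature.NumberTheory.Automorphic.PrincipalSeriesGL2JacquetModule
import Literature.NumberTheory.Automorphic.IdeleUnitBoxSplittingConstants
import HarnessLib

/-!
# The DUAL Hecke integrand `W̃_φ(diag(a, 1)) |a|^{s-1/2}` of a pure tensor cusp form of `GL₂` on the box of
# ideles integral off `S`, and its integral there (Jacquet–Langlands (1970), proof of Thm. 11.1, p. 231)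

Topic `NumberTheory/Automorphic`; namespace `Literature.NumberTheory.Automorphic`. Theorems only (no
definition, no named fact, no instance). The companion of `HeckeIntegrandPureTensorOnBox` for the involuted
Whittaker function `W̃_φ(g) = W_φ(w ᵗg⁻¹)` (`tildeFn`, `w = weylLong 2`), the integrand of the dual side of the
global functional equation (`WhittakerCoeffTransposeInvGL2`: `W_{φ∘ι}(diag(a,1)) = W̃_φ(diag(-a,1))`).

With the notation of `HeckeIntegrandPureTensorOnBox` (pure tensor `φ = e ⊗ j(x)` of a cuspidal `Π`, Flath
data `(ρ_v, x₀_v, j, λ_v, e_v)`, product formula `hprod` for `Λ₀`, line functional `ℓ_∞`), for a finite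
set `S` containing the places where `x_v ≠ x₀_v` or `x₀_v` is not spherical and an idele `a` that is a unit
off `S`:

* `weylLong_mem_glInt`, `glTransposeInv_glDiagonal`, `localComponent_weylLong_mul_glTransposeInv_glDiagonal`,
  `toMixed_weylLong_mul_glTransposeInv_glDiagonal` — bookkeeping: the `v`-component of
  `w ι(diag(a,1))` is `w ι(diag(a_v,1))`, its archimedean part is `w ι(diag(a_∞,1))`, and off `S` the
  `v`-component lies in `GL₂(𝒪_v)`;
* `tildeFn_whittakerDepth_zero_pureTensor_diag_of_mem_ideleUnitBox` — **the dual Whittaker function**: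

    `W̃_φ(diag(a,1)) = Λ₀(j(e_S)) · (∏_{v ∈ S} W̃_v(diag(a_v,1))) · ξ̃(a_∞)`,

  `W̃_v = tildeFn (whittakerModel ρ_v λ_v x_v)`, `ξ̃ = tildeFn (g ↦ ℓ_∞(τ(g) e))` read at `diag(u,1)`;
* `dualHeckeIntegrand_pureTensor_of_mem_ideleUnitBox` — with `|a|^s` split over the box;
* `setIntegral_ideleUnitBox_dualHeckeIntegrand_pureTensor` (**main**) — for a splitting constant `c` of
  `ν|_{B(Sᶜ)}` (hypothesis `hsplit`, as in `setIntegral_ideleUnitBox_heckeIntegrand_pureTensor`),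

    `∫_{B(Sᶜ)} W̃_φ(diag(a,1)) |a|^{s} dν = c · Λ₀(j(e_S)) · (∫ ξ̃(u) N(u)^{s} dμ_∞) · ∏_{v ∈ S} ∫ W̃_v(diag(y,1)) |y|_v^{s} dμ_v`

  with integrability on the box — the SAME constant `c` and the SAME prefactor `Λ₀(j(e_S))` as on the direct
  side, which is what makes the global functional equation `Ψ(s, φ) = Ψ̃(1-s, φ)` (an identity of folded
  integrals) descend to the products of local integrals with no extraneous constant.

## References

* H. Jacquet, R. P. Langlands, *Automorphic Forms on GL(2)*, LNM 114 (1970), Thm. 11.1, proof pp. 230–231,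
  and (11.1.2) p. 171 [JacquetLanglands1970].
* J. W. Cogdell, *Lectures on L-functions, converse theorems, and functoriality for GL_n* (2004), §2.3
  [CogdellAnalyticTheory2004].
-/

noncomputable section

open MeasureTheory Measure NumberField NumberField.mixedEmbedding IsDedekindDomain Set Filter
open Literature.NumberTheory.GaloisRepresentations (ideleGroup unitIdeles localUnits coe_glTransposeInv_apply)
open Literature.NumberTheory.GaloisRepresentations.IsNonarchimedeanLocalField (normAbs)
open scoped MatrixGroups InnerProductSpace Classical NNReal

namespace Literature.NumberTheory.Automorphic

variable {K : Type} [Field K] [NumberField K]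

/-! ### 1. Bookkeeping for the point `w ι(diag(a, 1))` -/

section Point

/-- The long Weyl element lies in `GL_n(𝒪)` (it is a permutation matrix). [folklore] -/
theorem weylLong_mem_glInt {F : Type*} [Field F] [ValuativeRel F] (n : ℕ) : weylLong n F ∈ glInt n F :=
  ⟨weylLong n _, map_weylLong _⟩

/-- `ι(diag(d)) = diag(d⁻¹)`. [folklore] -/
theorem glTransposeInv_glDiagonal {R : Type*} [CommRing R] [TopologicalSpace R] {n : ℕ} (d : Fin n → Rˣ) :
    GaloisRepresentations.glTransposeInv (Fin n) R (glDiagonal n R d) = glDiagonal n R d⁻¹ := by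
  refine Matrix.GeneralLinearGroup.ext fun i j => ?_
  rw [coe_glTransposeInv_apply, ← map_inv, Matrix.transpose_apply, coe_glDiagonal]
  by_cases h : i = j
  · subst h; rfl
  · rw [Matrix.diagonal_apply_ne _ (Ne.symm h), Matrix.diagonal_apply_ne _ h]

/-- The finite part of the adelic long Weyl element. [folklore] -/
theorem sndHom_weylLong (n : ℕ) :
    GLn.sndHom n K (weylLong n (AdeleRing (𝓞 K) K)) = weylLong n (FiniteAdeleRing (𝓞 K) K) :=
  map_weylLong _

/-- **The `v`-component of `w ι(diag(a,1))` is `w ι(diag(a_v, 1))`.** [folklore] -/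
theorem restrictedPiEquiv_sndHom_weylLong_mul_glTransposeInv_glDiagonal (a : ideleGroup K)
    (v : HeightOneSpectrum (𝓞 K)) :
    GLn.restrictedPiEquiv 2 K (GLn.sndHom 2 K ((weylLong 2 (AdeleRing (𝓞 K) K) : GL (Fin 2) (AdeleRing (𝓞 K) K)) *
        GaloisRepresentations.glTransposeInv (Fin 2) (AdeleRing (𝓞 K) K) (glDiagonal 2 (AdeleRing (𝓞 K) K) ![a, 1]))) v =
      weylLong 2 (v.adicCompletion K) *
        GaloisRepresentations.glTransposeInv (Fin 2) (v.adicCompletion K)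
          (diagGL2 ((GaloisRepresentations.ideleGroup.finComp (K := K) v).toHomUnits a) 1) := by
  rw [restrictedPiEquiv_sndHom_eq_localComponent]
  change Matrix.GeneralLinearGroup.map (AdelicGroupData.adeleEval K v)
      ((weylLong 2 (AdeleRing (𝓞 K) K) : GL (Fin 2) (AdeleRing (𝓞 K) K)) *
        GaloisRepresentations.glTransposeInv (Fin 2) (AdeleRing (𝓞 K) K) (glDiagonal 2 (AdeleRing (𝓞 K) K) ![a, 1])) = _
  rw [map_mul, map_weylLong, map_glTransposeInv, ← glDiagonal_finComp_vecCons_one,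
    ← restrictedPiEquiv_sndHom_glDiagonal, restrictedPiEquiv_sndHom_eq_localComponent]

/-- Off `S` the `v`-component of `w ι(diag(a,1))` lies in `GL₂(𝒪_v)` (`a` a unit at `v`). [folklore] -/
theorem weylLong_mul_glTransposeInv_diagGL2_mem_glInt {v : HeightOneSpectrum (𝓞 K)} {a : ideleGroup K}
    (ha : Valued.v (((a : ideleGroup K) : AdeleRing (𝓞 K) K).2 v) = 1) :
    weylLong 2 (v.adicCompletion K) *
        GaloisRepresentations.glTransposeInv (Fin 2) (v.adicCompletion K)
          (diagGL2 ((GaloisRepresentations.ideleGroup.finComp (K := K) v).toHomUnits a) 1) ∈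
      glInt 2 (v.adicCompletion K) := by
  refine Subgroup.mul_mem _ (weylLong_mem_glInt 2) ?_
  have hinv : (![(GaloisRepresentations.ideleGroup.finComp (K := K) v).toHomUnits a, (1 : (v.adicCompletion K)ˣ)] :
      Fin 2 → (v.adicCompletion K)ˣ)⁻¹ = ![((GaloisRepresentations.ideleGroup.finComp (K := K) v).toHomUnits a)⁻¹, 1] := by
    funext i; fin_cases i <;> simp
  rw [diagGL2, glTransposeInv_glDiagonal, hinv, ← diagGL2]
  refine diagGL2_mem_glInt ?_ (by rw [Units.val_one, map_one])
  rw [Units.val_inv_eq_inv_val, map_inv₀, inv_eq_one, ← valued_eq_one_iff_valuation_eq_one]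
  exact ha

/-- The archimedean part of the adelic long Weyl element. [folklore] -/
theorem toMixed_weylLong (n : ℕ) : GLn.toMixed n K (weylLong n (AdeleRing (𝓞 K) K)) = weylLong n (mixedSpace K) := by
  refine Matrix.GeneralLinearGroup.ext fun i j => ?_
  rw [GLn.coe_toMixed_apply, coe_weylLong, coe_weylLong, Equiv.Perm.permMatrix, Equiv.Perm.permMatrix,
    PEquiv.toMatrix_apply, PEquiv.toMatrix_apply]
  split_ifs
  · change InfiniteAdeleRing.ringEquiv_mixedSpace K 1 = 1
    exact map_one _
  · change InfiniteAdeleRing.ringEquiv_mixedSpace K 0 = 0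
    exact map_zero _

/-- `GLn.toMixed` commutes with `ι`. [folklore] -/
theorem toMixed_glTransposeInv {n : ℕ} (g : GL (Fin n) (AdeleRing (𝓞 K) K)) :
    GLn.toMixed n K (GaloisRepresentations.glTransposeInv (Fin n) (AdeleRing (𝓞 K) K) g) =
      GaloisRepresentations.glTransposeInv (Fin n) (mixedSpace K) (GLn.toMixed n K g) := by
  refine Matrix.GeneralLinearGroup.ext fun i j => ?_
  rw [GLn.coe_toMixed_apply, coe_glTransposeInv_apply, coe_glTransposeInv_apply, ← map_inv, Matrix.transpose_apply,
    Matrix.transpose_apply, GLn.coe_toMixed_apply]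

/-- **The archimedean part of `w ι(diag(a,1))` is `w ι(diag(a_∞, 1))`.** [folklore] -/
theorem toMixed_weylLong_mul_glTransposeInv_glDiagonal (a : ideleGroup K) :
    GLn.toMixed 2 K ((weylLong 2 (AdeleRing (𝓞 K) K) : GL (Fin 2) (AdeleRing (𝓞 K) K)) *
        GaloisRepresentations.glTransposeInv (Fin 2) (AdeleRing (𝓞 K) K) (glDiagonal 2 (AdeleRing (𝓞 K) K) ![a, 1])) =
      weylLong 2 (mixedSpace K) *
        GaloisRepresentations.glTransposeInv (Fin 2) (mixedSpace K) (diagGL2 (archUnitsOfIdele K a) 1) := by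
  rw [map_mul, toMixed_weylLong, toMixed_glTransposeInv, toMixed_glDiagonal_eq_archTorusOfIdele,
    glDiagonal_archTorusOfIdele_vecCons_one]

end Point

/-! ### 2. The dual Whittaker function and the dual Hecke integrand of a pure tensor on the box -/

section Box

variable {μ : Measure (AdelicGroupData.gl 2 K).automorphicQuotient}
  [(AdelicGroupData.gl 2 K).IsAutomorphicMeasure μ]

-- the house Borel structures on `GL₂(𝔸_K)` (as in `PureTensorCuspForm`)
attribute [local instance] adelicBorel borelSpace_adelic locallyCompactSpace_adelic
  secondCountableTopology_gl_adelic glAdeleBorel borelSpace_glAdele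

set_option backward.isDefEq.respectTransparency false

variable {hcpt : isCompact_glFiniteIntegralLevel 2 K}
  {E : Type*} [NormedAddCommGroup E] [InnerProductSpace ℂ E] [CompleteSpace E]
  {τ : ContRepresentation ℂ (AutomorphyDatum.gl 2 K hcpt).arch.carrier E}
  {V : HeightOneSpectrum (𝓞 K) → Type*} [∀ v, AddCommGroup (V v)] [∀ v, Module ℂ (V v)]

/-- **The dual Whittaker function of a pure tensor cusp form of `GL₂` at `diag(a, 1)`, `a` a unit off `S`**:

  `W̃_φ(diag(a,1)) = Λ₀(j(e_S)) · (∏_{v ∈ S} W̃_v(diag(a_v,1))) · ξ̃(a_∞)`,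

`W̃_v = tildeFn (whittakerModel ρ_v λ_v x_v)`, `ξ̃(u) = tildeFn (g ↦ ℓ_∞(τ(g) e)) (diag(u,1))`
(`whittakerDepth_zero_pureTensor_eq_mul_prod` at the point `w ι(diag(a,1))`, whose `v`-components off `S` lie in
`GL₂(𝒪_v)`). [cite: JacquetLanglands1970, Thm. 11.1, proof p. 231] [cite: CogdellAnalyticTheory2004, §2.3] -/
theorem tildeFn_whittakerDepth_zero_pureTensor_diag_of_mem_ideleUnitBox (P : CuspidalAutomorphicRepGL 2 K μ)
    (hτ : τ.IsStronglyContinuous) (ν₀ : Measure ↥(adelicUnipotent 2 K)) [IsHaarMeasure ν₀]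
    {T₀ : multiplicityModule hcpt τ P.1} {Λ₀ : multiplicityModule hcpt τ P.1 →ₗ[ℂ] ℂ}
    (hΛ : ∀ T : multiplicityModule hcpt τ P.1,
      transferMap (whittakerFunctional ν₀ (continuous_adeleAddChar K)
        (ContRepresentation.Equiv.refl P.1.toContRep)) hτ T =
        Λ₀ T • transferMap (whittakerFunctional ν₀ (continuous_adeleAddChar K)
          (ContRepresentation.Equiv.refl P.1.toContRep)) hτ T₀)
    {ρ : ∀ v : HeightOneSpectrum (𝓞 K), Representation ℂ (GL (Fin 2) (v.adicCompletion K)) (V v)}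
    {x₀ : ∀ v, V v} {j : RestrictedFamily V x₀ → multiplicityModule hcpt τ P.1}
    {lam : ∀ v, Module.Dual ℂ (V v)} {eu : ∀ v, V v}
    (hprod : ∀ (S : Finset (HeightOneSpectrum (𝓞 K))) (gf : GL (Fin 2) (FiniteAdeleRing (𝓞 K) K))
      (x : RestrictedFamily V x₀), (∀ v ∉ S, ρ v (GLn.restrictedPiEquiv 2 K gf v) (x v) = x₀ v) →
      Λ₀ (finComponentRep hcpt τ P.1 gf (j x)) =
        Λ₀ (j (RestrictedFamily.extend S fun v : S => eu v)) *
          ∏ v ∈ S, lam v (ρ v (GLn.restrictedPiEquiv 2 K gf v) (x v)))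
    (S : Finset (HeightOneSpectrum (𝓞 K))) (x : RestrictedFamily V x₀) (e : archGardingSpace hcpt τ)
    (hxS : ∀ v ∉ S, x v = x₀ v)
    (hfix : ∀ v ∉ S, x₀ v ∈ (ρ v).fixedPoints (glInt 2 (v.adicCompletion K)))
    {a : ideleGroup K} (ha : a ∈ ideleUnitBox (K := K) {w | w ∉ S}) :
    tildeFn (whittakerDepth 0 (invQuot (AdelicGroupData.gl 2 K)
        (contRep (((j x : multiplicityModule hcpt τ P.1) : E →L[ℂ] (AdelicGroupData.gl 2 K).L2 μ) (e : E)))))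
        (glDiagonal 2 (AdeleRing (𝓞 K) K) ![a, 1]) =
      Λ₀ (j (RestrictedFamily.extend S fun v : S => eu v)) *
        (∏ v ∈ S, tildeFn (whittakerModel (ρ v) (lam v) (x v))
          (diagGL2 ((GaloisRepresentations.ideleGroup.finComp (K := K) v).toHomUnits a) 1)) *
        tildeFn (fun g : GL (Fin 2) (mixedSpace K) =>
          transferMap (whittakerFunctional ν₀ (continuous_adeleAddChar K)
            (ContRepresentation.Equiv.refl P.1.toContRep)) hτ T₀
            ⟨τ (toArch hcpt g) (e : E), apply_mem_archGardingSpace hτ _ e.2⟩)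
          (diagGL2 (archUnitsOfIdele K a) 1) := by
  set g : GL (Fin 2) (AdeleRing (𝓞 K) K) := (weylLong 2 (AdeleRing (𝓞 K) K) : GL (Fin 2) (AdeleRing (𝓞 K) K)) *
    GaloisRepresentations.glTransposeInv (Fin 2) (AdeleRing (𝓞 K) K) (glDiagonal 2 (AdeleRing (𝓞 K) K) ![a, 1]) with hg
  have hcomp : ∀ v, GLn.restrictedPiEquiv 2 K (GLn.sndHom 2 K g) v =
      weylLong 2 (v.adicCompletion K) * GaloisRepresentations.glTransposeInv (Fin 2) (v.adicCompletion K)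
        (diagGL2 ((GaloisRepresentations.ideleGroup.finComp (K := K) v).toHomUnits a) 1) :=
    fun v => restrictedPiEquiv_sndHom_weylLong_mul_glTransposeInv_glDiagonal a v
  have hgS : ∀ v ∉ S, ρ v (GLn.restrictedPiEquiv 2 K (GLn.sndHom 2 K g) v) (x v) = x₀ v := by
    intro v hv
    rw [hcomp v, hxS v hv]
    exact ((ρ v).mem_fixedPoints _ _).1 (hfix v hv) _
      (weylLong_mul_glTransposeInv_diagGL2_mem_glInt (ha v hv))
  rw [tildeFn_apply, whittakerDepth_zero_pureTensor_eq_mul_prod P hτ (by norm_num) ν₀ hΛ hprod S x e g hgS]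
  have hprodS : (∏ v ∈ S, lam v (ρ v (GLn.restrictedPiEquiv 2 K (GLn.sndHom 2 K g) v) (x v))) =
      ∏ v ∈ S, tildeFn (whittakerModel (ρ v) (lam v) (x v))
        (diagGL2 ((GaloisRepresentations.ideleGroup.finComp (K := K) v).toHomUnits a) 1) :=
    Finset.prod_congr rfl fun v _ => by rw [hcomp v, tildeFn_apply, whittakerModel_apply]
  have harch : (⟨τ (toArch hcpt (GLn.toMixed 2 K g)) (e : E), apply_mem_archGardingSpace hτ _ e.2⟩ :
      archGardingSpace hcpt τ) =
      ⟨τ (toArch hcpt (weylLong 2 (mixedSpace K) * GaloisRepresentations.glTransposeInv (Fin 2) (mixedSpace K)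
        (diagGL2 (archUnitsOfIdele K a) 1))) (e : E), apply_mem_archGardingSpace hτ _ e.2⟩ := by
    apply Subtype.ext
    change τ (toArch hcpt (GLn.toMixed 2 K g)) (e : E) = _
    rw [hg, toMixed_weylLong_mul_glTransposeInv_glDiagonal]
  rw [hprodS, harch, tildeFn_apply]

/-- **The dual Hecke integrand of a pure tensor on the box**: for `a` a unit off `S`,

  `W̃_φ(diag(a,1)) |a|^{s} = Λ₀(j(e_S)) · (ξ̃(a_∞) N(a_∞)^{s}) · ∏_{v ∈ S} W̃_v(diag(a_v,1)) |a_v|_v^{s}`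

(apply with `s - 1/2`). [cite: JacquetLanglands1970, Thm. 11.1, proof p. 231] -/
theorem dualHeckeIntegrand_pureTensor_of_mem_ideleUnitBox (P : CuspidalAutomorphicRepGL 2 K μ)
    (hτ : τ.IsStronglyContinuous) (ν₀ : Measure ↥(adelicUnipotent 2 K)) [IsHaarMeasure ν₀]
    {T₀ : multiplicityModule hcpt τ P.1} {Λ₀ : multiplicityModule hcpt τ P.1 →ₗ[ℂ] ℂ}
    (hΛ : ∀ T : multiplicityModule hcpt τ P.1,
      transferMap (whittakerFunctional ν₀ (continuous_adeleAddChar K)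
        (ContRepresentation.Equiv.refl P.1.toContRep)) hτ T =
        Λ₀ T • transferMap (whittakerFunctional ν₀ (continuous_adeleAddChar K)
          (ContRepresentation.Equiv.refl P.1.toContRep)) hτ T₀)
    {ρ : ∀ v : HeightOneSpectrum (𝓞 K), Representation ℂ (GL (Fin 2) (v.adicCompletion K)) (V v)}
    {x₀ : ∀ v, V v} {j : RestrictedFamily V x₀ → multiplicityModule hcpt τ P.1}
    {lam : ∀ v, Module.Dual ℂ (V v)} {eu : ∀ v, V v}
    (hprod : ∀ (S : Finset (HeightOneSpectrum (𝓞 K))) (gf : GL (Fin 2) (FiniteAdeleRing (𝓞 K) K))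
      (x : RestrictedFamily V x₀), (∀ v ∉ S, ρ v (GLn.restrictedPiEquiv 2 K gf v) (x v) = x₀ v) →
      Λ₀ (finComponentRep hcpt τ P.1 gf (j x)) =
        Λ₀ (j (RestrictedFamily.extend S fun v : S => eu v)) *
          ∏ v ∈ S, lam v (ρ v (GLn.restrictedPiEquiv 2 K gf v) (x v)))
    (S : Finset (HeightOneSpectrum (𝓞 K))) (x : RestrictedFamily V x₀) (e : archGardingSpace hcpt τ)
    (hxS : ∀ v ∉ S, x v = x₀ v)
    (hfix : ∀ v ∉ S, x₀ v ∈ (ρ v).fixedPoints (glInt 2 (v.adicCompletion K)))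
    (s : ℂ) {a : ideleGroup K} (ha : a ∈ ideleUnitBox (K := K) {w | w ∉ S}) :
    tildeFn (whittakerDepth 0 (invQuot (AdelicGroupData.gl 2 K)
        (contRep (((j x : multiplicityModule hcpt τ P.1) : E →L[ℂ] (AdelicGroupData.gl 2 K).L2 μ) (e : E)))))
        (glDiagonal 2 (AdeleRing (𝓞 K) K) ![a, 1]) *
        ((IdeleClassGroup.ideleNorm K a : ℝ) : ℂ) ^ s =
      Λ₀ (j (RestrictedFamily.extend S fun v : S => eu v)) *
        (tildeFn (fun g : GL (Fin 2) (mixedSpace K) =>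
            transferMap (whittakerFunctional ν₀ (continuous_adeleAddChar K)
              (ContRepresentation.Equiv.refl P.1.toContRep)) hτ T₀
              ⟨τ (toArch hcpt g) (e : E), apply_mem_archGardingSpace hτ _ e.2⟩)
            (diagGL2 (archUnitsOfIdele K a) 1) *
          ((mixedEmbedding.norm ((archUnitsOfIdele K a : (mixedSpace K)ˣ) : mixedSpace K) : ℝ) : ℂ) ^ s) *
        ∏ v ∈ S, (tildeFn (whittakerModel (ρ v) (lam v) (x v))
            (diagGL2 ((GaloisRepresentations.ideleGroup.finComp (K := K) v).toHomUnits a) 1) *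
          ((((normAbs (v.adicCompletion K)
            (((GaloisRepresentations.ideleGroup.finComp (K := K) v).toHomUnits a : (v.adicCompletion K)ˣ) :
              v.adicCompletion K) : ℝ≥0) : ℝ) : ℂ) ^ s)) := by
  rw [tildeFn_whittakerDepth_zero_pureTensor_diag_of_mem_ideleUnitBox P hτ ν₀ hΛ hprod S x e hxS hfix ha,
    ideleNorm_cpow_eq_of_mem_ideleUnitBox ha s, Finset.prod_mul_distrib]
  ring

variable [MeasurableSpace (ideleGroup K)] [BorelSpace (ideleGroup K)]
  [MeasurableSpace ((mixedSpace K)ˣ)]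
  [∀ v : HeightOneSpectrum (𝓞 K), MeasurableSpace ((v.adicCompletion K)ˣ)]

/-- **MAIN. The integral of the dual Hecke integrand of a pure tensor over the box `B(Sᶜ)`** (same shape,
same constant and same prefactor as `setIntegral_ideleUnitBox_heckeIntegrand_pureTensor`): with a splitting
constant `c` of `ν|_{B(Sᶜ)}` on product integrands (hypothesis `hsplit`), for every `s` at which the dual
archimedean integrand `ξ̃ N^{s}` and the dual local integrands `W̃_v(diag(·,1)) |·|_v^{s}`, `v ∈ S`, are
integrable, the dual Hecke integrand is integrable on the box and

  `∫_{B(Sᶜ)} W̃_φ(diag(a,1)) |a|^{s} dν(a) = c · Λ₀(j(e_S)) · (∫ ξ̃(u) N(u)^{s} dμ_∞(u)) · ∏_{v ∈ S} ∫ W̃_v(diag(y,1)) |y|_v^{s} dμ_v(y)`.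

[cite: JacquetLanglands1970, Thm. 11.1, proof pp. 230–231, and §11 (11.1.2)] -/
theorem setIntegral_ideleUnitBox_dualHeckeIntegrand_pureTensor (P : CuspidalAutomorphicRepGL 2 K μ)
    (hτ : τ.IsStronglyContinuous) (ν₀ : Measure ↥(adelicUnipotent 2 K)) [IsHaarMeasure ν₀]
    {T₀ : multiplicityModule hcpt τ P.1} {Λ₀ : multiplicityModule hcpt τ P.1 →ₗ[ℂ] ℂ}
    (hΛ : ∀ T : multiplicityModule hcpt τ P.1,
      transferMap (whittakerFunctional ν₀ (continuous_adeleAddChar K)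
        (ContRepresentation.Equiv.refl P.1.toContRep)) hτ T =
        Λ₀ T • transferMap (whittakerFunctional ν₀ (continuous_adeleAddChar K)
          (ContRepresentation.Equiv.refl P.1.toContRep)) hτ T₀)
    {ρ : ∀ v : HeightOneSpectrum (𝓞 K), Representation ℂ (GL (Fin 2) (v.adicCompletion K)) (V v)}
    {x₀ : ∀ v, V v} {j : RestrictedFamily V x₀ → multiplicityModule hcpt τ P.1}
    {lam : ∀ v, Module.Dual ℂ (V v)} {eu : ∀ v, V v}
    (hprod : ∀ (S : Finset (HeightOneSpectrum (𝓞 K))) (gf : GL (Fin 2) (FiniteAdeleRing (𝓞 K) K))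
      (x : RestrictedFamily V x₀), (∀ v ∉ S, ρ v (GLn.restrictedPiEquiv 2 K gf v) (x v) = x₀ v) →
      Λ₀ (finComponentRep hcpt τ P.1 gf (j x)) =
        Λ₀ (j (RestrictedFamily.extend S fun v : S => eu v)) *
          ∏ v ∈ S, lam v (ρ v (GLn.restrictedPiEquiv 2 K gf v) (x v)))
    (S : Finset (HeightOneSpectrum (𝓞 K))) (x : RestrictedFamily V x₀) (e : archGardingSpace hcpt τ)
    (hxS : ∀ v ∉ S, x v = x₀ v)
    (hfix : ∀ v ∉ S, x₀ v ∈ (ρ v).fixedPoints (glInt 2 (v.adicCompletion K)))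
    (ν : Measure (ideleGroup K)) (μinf : Measure (mixedSpace K)ˣ)
    (μv : ∀ v : HeightOneSpectrum (𝓞 K), Measure (v.adicCompletion K)ˣ) {c : ℝ≥0}
    (hsplit : ∀ (g : (mixedSpace K)ˣ → ℂ) (h : ∀ v : ↥S, (v.1.adicCompletion K)ˣ → ℂ),
      Integrable g μinf → (∀ v, Integrable (h v) (μv v.1)) →
      IntegrableOn (fun a : ideleGroup K => g (archUnitsOfIdele K a) *
          ∏ v : ↥S, h v ((GaloisRepresentations.ideleGroup.finComp v.1).toHomUnits a))
        (ideleUnitBox (K := K) {w | w ∉ S}) ν ∧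
      ∫ a in ideleUnitBox (K := K) {w | w ∉ S}, g (archUnitsOfIdele K a) *
          ∏ v : ↥S, h v ((GaloisRepresentations.ideleGroup.finComp v.1).toHomUnits a) ∂ν =
        (c : ℂ) * (∫ x, g x ∂μinf) * ∏ v : ↥S, ∫ y, h v y ∂(μv v.1))
    (s : ℂ)
    (hgi : Integrable (fun u : (mixedSpace K)ˣ =>
      tildeFn (fun g : GL (Fin 2) (mixedSpace K) =>
          transferMap (whittakerFunctional ν₀ (continuous_adeleAddChar K)
            (ContRepresentation.Equiv.refl P.1.toContRep)) hτ T₀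
            ⟨τ (toArch hcpt g) (e : E), apply_mem_archGardingSpace hτ _ e.2⟩) (diagGL2 u 1) *
        ((mixedEmbedding.norm ((u : (mixedSpace K)ˣ) : mixedSpace K) : ℝ) : ℂ) ^ s) μinf)
    (hhi : ∀ v ∈ S, Integrable (fun y : (v.adicCompletion K)ˣ =>
      tildeFn (whittakerModel (ρ v) (lam v) (x v)) (diagGL2 y 1) *
        (((normAbs (v.adicCompletion K) (y : v.adicCompletion K) : ℝ≥0) : ℝ) : ℂ) ^ s) (μv v)) :
    IntegrableOn (fun a : ideleGroup K =>
        tildeFn (whittakerDepth 0 (invQuot (AdelicGroupData.gl 2 K)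
          (contRep (((j x : multiplicityModule hcpt τ P.1) : E →L[ℂ] (AdelicGroupData.gl 2 K).L2 μ) (e : E)))))
          (glDiagonal 2 (AdeleRing (𝓞 K) K) ![a, 1]) *
        ((IdeleClassGroup.ideleNorm K a : ℝ) : ℂ) ^ s) (ideleUnitBox (K := K) {w | w ∉ S}) ν ∧
    ∫ a in ideleUnitBox (K := K) {w | w ∉ S},
        tildeFn (whittakerDepth 0 (invQuot (AdelicGroupData.gl 2 K)
          (contRep (((j x : multiplicityModule hcpt τ P.1) : E →L[ℂ] (AdelicGroupData.gl 2 K).L2 μ) (e : E)))))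
          (glDiagonal 2 (AdeleRing (𝓞 K) K) ![a, 1]) *
        ((IdeleClassGroup.ideleNorm K a : ℝ) : ℂ) ^ s ∂ν =
      (c : ℂ) * Λ₀ (j (RestrictedFamily.extend S fun v : S => eu v)) *
        (∫ u : (mixedSpace K)ˣ, tildeFn (fun g : GL (Fin 2) (mixedSpace K) =>
            transferMap (whittakerFunctional ν₀ (continuous_adeleAddChar K)
              (ContRepresentation.Equiv.refl P.1.toContRep)) hτ T₀
              ⟨τ (toArch hcpt g) (e : E), apply_mem_archGardingSpace hτ _ e.2⟩) (diagGL2 u 1) *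
          ((mixedEmbedding.norm ((u : (mixedSpace K)ˣ) : mixedSpace K) : ℝ) : ℂ) ^ s ∂μinf) *
        ∏ v ∈ S, ∫ y : (v.adicCompletion K)ˣ, tildeFn (whittakerModel (ρ v) (lam v) (x v)) (diagGL2 y 1) *
          (((normAbs (v.adicCompletion K) (y : v.adicCompletion K) : ℝ≥0) : ℝ) : ℂ) ^ s ∂(μv v) := by
  -- the archimedean and local integrands
  set g : (mixedSpace K)ˣ → ℂ := fun u =>
    tildeFn (fun g : GL (Fin 2) (mixedSpace K) =>
        transferMap (whittakerFunctional ν₀ (continuous_adeleAddChar K)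
          (ContRepresentation.Equiv.refl P.1.toContRep)) hτ T₀
          ⟨τ (toArch hcpt g) (e : E), apply_mem_archGardingSpace hτ _ e.2⟩) (diagGL2 u 1) *
      ((mixedEmbedding.norm ((u : (mixedSpace K)ˣ) : mixedSpace K) : ℝ) : ℂ) ^ s with hgdef
  set h : ∀ v : ↥S, (v.1.adicCompletion K)ˣ → ℂ := fun v y =>
    tildeFn (whittakerModel (ρ v.1) (lam v.1) (x v.1)) (diagGL2 y 1) *
      (((normAbs (v.1.adicCompletion K) (y : v.1.adicCompletion K) : ℝ≥0) : ℝ) : ℂ) ^ s with hh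
  obtain ⟨hint, hval⟩ := hsplit g h hgi (fun v => hhi v.1 v.2)
  -- the integrand on the box is `Λ₀(j(e_S)) · g(a_∞) · ∏_{v ∈ S} h_v(a_v)`
  have hpt : ∀ a ∈ ideleUnitBox (K := K) {w | w ∉ S},
      tildeFn (whittakerDepth 0 (invQuot (AdelicGroupData.gl 2 K)
          (contRep (((j x : multiplicityModule hcpt τ P.1) : E →L[ℂ] (AdelicGroupData.gl 2 K).L2 μ) (e : E)))))
          (glDiagonal 2 (AdeleRing (𝓞 K) K) ![a, 1]) *
        ((IdeleClassGroup.ideleNorm K a : ℝ) : ℂ) ^ s =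
      Λ₀ (j (RestrictedFamily.extend S fun v : S => eu v)) *
        (g (archUnitsOfIdele K a) *
          ∏ v : ↥S, h v ((GaloisRepresentations.ideleGroup.finComp (K := K) v.1).toHomUnits a)) := by
    intro a ha
    rw [dualHeckeIntegrand_pureTensor_of_mem_ideleUnitBox P hτ ν₀ hΛ hprod S x e hxS hfix s ha,
      ← Finset.prod_coe_sort S]
    simp only [hgdef, hh]
    ring
  obtain ⟨ϖ, hϖ⟩ : ∃ ϖ : ∀ v : HeightOneSpectrum (𝓞 K), (v.adicCompletion K)ˣ,
      ∀ v, Valued.v ((ϖ v : (v.adicCompletion K)ˣ) : v.adicCompletion K) = WithZero.exp (-1 : ℤ) :=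
    ⟨fun v => GaloisRepresentations.HeckeCharacter.uniformizer K v, fun v => GaloisRepresentations.HeckeCharacter.valued_uniformizer v⟩
  have hBm : MeasurableSet (ideleUnitBox (K := K) {w | w ∉ S}) := measurableSet_ideleUnitBox_compl ϖ hϖ S
  refine ⟨?_, ?_⟩
  · have h2 : IntegrableOn (fun a : ideleGroup K => Λ₀ (j (RestrictedFamily.extend S fun v : S => eu v)) *
        (g (archUnitsOfIdele K a) *
          ∏ v : ↥S, h v ((GaloisRepresentations.ideleGroup.finComp (K := K) v.1).toHomUnits a)))
        (ideleUnitBox (K := K) {w | w ∉ S}) ν := hint.const_mul _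
    exact h2.congr_fun (fun a ha => (hpt a ha).symm) hBm
  · rw [setIntegral_congr_fun hBm hpt, integral_const_mul, hval]
    have hprodS : (∏ v : ↥S, ∫ y, h v y ∂(μv v.1)) =
        ∏ v ∈ S, ∫ y : (v.adicCompletion K)ˣ, tildeFn (whittakerModel (ρ v) (lam v) (x v)) (diagGL2 y 1) *
          (((normAbs (v.adicCompletion K) (y : v.adicCompletion K) : ℝ≥0) : ℝ) : ℂ) ^ s ∂(μv v) := by
      rw [← Finset.prod_coe_sort S]
    rw [hprodS]
    ring

end Box

end Literature.NumberTheory.Automorphic
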